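import Literature.Computability.Complexity.DrivenSignMachineBlocks
import HarnessLib

/-!
# The oracle-driven sign machine, IV: running a frame strategy (search, probe, record)

Topic `Literature/Computability/Complexity`, grouping namespace `FKTransfer`, sequel of
`DrivenSignMachineBlocks.lean`. The point-location procedure of Fournier–Koiran (ICALP 2000 = LIP
RR-1999-21, §2.1) is a sequence of rounds of the same shape: knowing the outcomes so far, FIND an
object by prefix search with the `NP` oracle (a hyperplane of `H_n^k`, the next space `E_{i+1}`, an
apex `s_n^k`, …, or nothing at all for a plain binary-search step), then TEST the input against one
integer affine form computed from it, and record the answer. This file runs such a **frame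
strategy** on the driven sign machine and returns its outcomes as a plain list, so that the
correctness of a location procedure becomes a statement about lists of (witness, sign bit) pairs:

* a strategy at a fixed dimension is a pair (`R`, `code`): `R h w` says that `w` (a string of
  length `s`) is an admissible witness after the outcomes `h : List (List Bool × Bool)`, and
  `code h w` (a string of length `m`) is the sign query to probe next; `flat code h` is the
  transcript a history `h` occupies (frame = `w ++ code h w ++ [b]`), `ValidHist R code σ h` says
  that every recorded witness was admissible and every recorded bit is the true sign bit;
* `Implements δ R code σ s F` — the driver prefix-searches `R h` and then transmits `code h w`, on
  every valid history of fewer than `F` frames (`DrivenSignMachineBlocks.IsPrefixSearchDriver`,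
  `IsTransmitDriver`);
* **`exists_validHist_stream_eq`**: if the driver implements the strategy and admissible witnesses
  exist along valid histories, then after `F` frames (period `P = s + m + 1`, `F · P ≤ T`) the
  stream of the driven machine IS `flat code h` for a valid history `h` of length `F`. With
  `DrivenSignMachineStream.mem_PAddRel_of_driver` this reduces `L ∈ P⁰_ℝovs(A)` to: (i) witnesses
  exist (geometry), (ii) valid full histories decide `x ∈ L n` through the driver's last answer,
  (iii) the driver language is in the intended class (e.g. `NP`).

## References

* H. Fournier, P. Koiran, *Lower bounds are not easier over the reals: inside PH*, ICALP 2000,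
  LNCS 1853 = LIP RR-1999-21, §2.1 (Steps 1 and `k`: binary search, prefix searches, tests).
  [FournierKoiran2000]
-/

namespace Literature.Computability.Complexity

namespace FKTransfer

/-! ### Histories and the transcript they occupy -/

section Flat

variable (code : List (List Bool × Bool) → List Bool → List Bool)

/-- The transcript occupied by the history `t` recorded after the earlier history `pre`: each frame
is `w ++ code h w ++ [b]` with `h` the history before it. [cite: FournierKoiran2000, §2.1] -/
def flatAux : List (List Bool × Bool) → List (List Bool × Bool) → List Bool
  | _, [] => []
  | pre, e :: t => e.1 ++ code pre e.1 ++ [e.2] ++ flatAux (pre ++ [e]) t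

/-- The transcript occupied by a history. [cite: FournierKoiran2000, §2.1] -/
def flat (h : List (List Bool × Bool)) : List Bool :=
  flatAux code [] h

variable {code}

/-- `flatAux` of an appended frame. [folklore] -/
theorem flatAux_append_singleton (pre : List (List Bool × Bool)) :
    ∀ (t : List (List Bool × Bool)) (e : List Bool × Bool),
      flatAux code pre (t ++ [e]) = flatAux code pre t ++ (e.1 ++ code (pre ++ t) e.1 ++ [e.2])
  | [], e => by simp [flatAux]
  | e' :: t, e => by
    rw [List.cons_append, flatAux, flatAux, flatAux_append_singleton (pre ++ [e']) t e, List.append_assoc]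
    simp

/-- **One more frame**: `flat (h ++ [(w, b)]) = flat h ++ w ++ code h w ++ [b]`. [folklore] -/
theorem flat_append_singleton (h : List (List Bool × Bool)) (w : List Bool) (b : Bool) :
    flat code (h ++ [(w, b)]) = flat code h ++ (w ++ code h w ++ [b]) := by
  rw [flat, flat, flatAux_append_singleton]
  simp

/-- `flat [] = []`. [folklore] -/
@[simp] theorem flat_nil : flat code [] = [] := rfl

/-- Length of the transcript of a history with witnesses of length `s` and codes of length `m`.
[folklore] -/
theorem length_flat {s m : ℕ} (hcode : ∀ h w, (code h w).length = m) :
    ∀ h : List (List Bool × Bool), (∀ e ∈ h, e.1.length = s) → (flat code h).length = h.length * (s + m + 1) := by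
  intro h
  induction h using List.reverseRecOn with
  | nil => intro _; simp
  | append_singleton h e ih =>
    intro hs
    obtain ⟨w, b⟩ := e
    rw [flat_append_singleton, List.length_append, ih (fun e he => hs e (List.mem_append_left _ he)),
      List.length_append, List.length_singleton]
    simp only [List.length_append, List.length_singleton, hcode,
      hs (w, b) (List.mem_append_right _ (List.mem_singleton_self _))]
    ring

end Flat

/-! ### Valid histories, implemented strategies -/

section Strategy

variable (R : List (List Bool × Bool) → List Bool → Prop)
  (code : List (List Bool × Bool) → List Bool → List Bool) (σ : List Bool → Bool)

/-- A history is VALID if every recorded witness was admissible after the history before it and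
every recorded bit is the sign bit of the probed form. [cite: FournierKoiran2000, §2.1] -/
def ValidHist (h : List (List Bool × Bool)) : Prop :=
  ∀ (i : ℕ) (hi : i < h.length),
    R (h.take i) (h.get ⟨i, hi⟩).1 ∧ (h.get ⟨i, hi⟩).2 = σ (code (h.take i) (h.get ⟨i, hi⟩).1)

/-- The driver `δ` IMPLEMENTS the strategy for `F` frames: on every valid history `h` of fewer than
`F` frames it prefix-searches `R h` for `s` rounds after the transcript `flat h`, and after an
admissible witness `w` it transmits `code h w` (a property of `δ`, not a statement).
[cite: FournierKoiran2000, §2.1] -/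
def Implements (δ : List Bool → Bool) (s F : ℕ) : Prop :=
  ∀ h : List (List Bool × Bool), h.length < F → ValidHist R code σ h →
    IsPrefixSearchDriver δ (flat code h) (R h) s ∧
      ∀ w : List Bool, w.length = s → R h w → IsTransmitDriver δ (flat code h ++ w) (code h w)

variable {R code σ}

/-- The empty history is valid. [folklore] -/
theorem validHist_nil : ValidHist R code σ [] := fun _ hi => absurd hi (Nat.not_lt_zero _)

/-- **Extending a valid history** by an admissible witness and the true sign bit. [folklore] -/
theorem ValidHist.append_singleton {h : List (List Bool × Bool)} (hv : ValidHist R code σ h)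
    {w : List Bool} (hw : R h w) : ValidHist R code σ (h ++ [(w, σ (code h w))]) := by
  intro i hi
  rw [List.length_append, List.length_singleton] at hi
  rcases Nat.lt_succ_iff_lt_or_eq.1 hi with hlt | rfl
  · have hget : (h ++ [(w, σ (code h w))]).get ⟨i, by simpa using hi⟩ = h.get ⟨i, hlt⟩ := by
      simp [List.getElem_append_left hlt]
    rw [hget, List.take_append_of_le_length hlt.le]
    exact hv i hlt
  · have hget : (h ++ [(w, σ (code h w))]).get ⟨h.length, by simp⟩ = (w, σ (code h w)) := by
      simp
    rw [hget, List.take_left']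
    · exact ⟨hw, rfl⟩
    · rfl

/-- Witnesses of a valid history have length `s` when admissible witnesses do. [folklore] -/
theorem ValidHist.length_eq {h : List (List Bool × Bool)} (hv : ValidHist R code σ h) {s : ℕ}
    (hs : ∀ h' w, R h' w → w.length = s) : ∀ e ∈ h, e.1.length = s := by
  intro e he
  obtain ⟨i, rfl⟩ := List.mem_iff_get.1 he
  exact hs _ _ (hv i.1 i.2).1

end Strategy

/-! ### Running a strategy on the driven machine -/

section Run

variable {δ σ : List Bool → Bool} {s m F T : ℕ}
  {R : List (List Bool × Bool) → List Bool → Prop}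
  {code : List (List Bool × Bool) → List Bool → List Bool}

/-- **The stream of an implemented strategy is the transcript of a valid history.** With period
`P = s + m + 1` and `F · P ≤ T`: if the driver implements `(R, code)` for `F` frames, codes have
length `m`, admissible witnesses have length `s` and exist after every valid history of fewer than
`F` frames, then for every `f ≤ F` the stream after `f` frames is `flat code h` for a valid history
`h` of length `f`. [cite: FournierKoiran2000, §2.1 (the data `c_n^k`, `s_n^k`, … found step by step)] -/
theorem exists_validHist_stream_eq (himpl : Implements R code σ δ s F)
    (hcode : ∀ h w, (code h w).length = m) (hs : ∀ h w, R h w → w.length = s)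
    (hex : ∀ h : List (List Bool × Bool), h.length < F → ValidHist R code σ h → ∃ w, w.length = s ∧ R h w)
    (hT : F * (s + m + 1) ≤ T) :
    ∀ f ≤ F, ∃ h : List (List Bool × Bool), h.length = f ∧ ValidHist R code σ h ∧
      stream δ σ m (s + m + 1) T (f * (s + m + 1)) = flat code h := by
  intro f
  induction f with
  | zero => intro _; exact ⟨[], rfl, validHist_nil, by simp⟩
  | succ f ih =>
    intro hf
    obtain ⟨h, hlen, hv, hstream⟩ := ih (Nat.le_of_succ_le hf)
    have hfF : h.length < F := by omega
    obtain ⟨hsearch, htrans⟩ := himpl h hfF hv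
    obtain ⟨w, hw, hRw, hblock⟩ := driveBits_search_then_transmit (δ := δ) (fun w => hcode h w) hsearch
      (hex h hfF hv) htrans
    have hframe := stream_frame (δ := δ) (σ := σ) (m := m) (P := s + m + 1) (T := T) (f := f) (by omega)
      (by have := Nat.mul_le_mul_right (s + m + 1) hf; rw [Nat.succ_mul] at this; omega)
    refine ⟨h ++ [(w, σ (code h w))], by rw [List.length_append, List.length_singleton, hlen], hv.append_singleton hRw, ?_⟩
    rw [Nat.succ_mul, hframe, hstream, show s + m + 1 - 1 = s + m from rfl, hblock, flat_append_singleton]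
    have hdrop : (flat code h ++ (w ++ code h w)).drop (f * (s + m + 1) + (s + m) - m) = code h w := by
      have hl : (flat code h).length = f * (s + m + 1) := by
        rw [length_flat hcode h (hv.length_eq hs), hlen]
      rw [← List.append_assoc, List.drop_left']
      rw [List.length_append, hl, hw]
      omega
    rw [hdrop]
    simp [List.append_assoc]

/-- **The final stream of an implemented strategy**: after all `F` frames (and with `T = F · P`
exactly) the stream the driver is asked about in the verdict round is `flat code h` for a valid
history `h` of length `F`. [cite: FournierKoiran2000, §2.1 with Thm 3 (p. 11)] -/
theorem exists_validHist_stream_T (himpl : Implements R code σ δ s F)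
    (hcode : ∀ h w, (code h w).length = m) (hs : ∀ h w, R h w → w.length = s)
    (hex : ∀ h : List (List Bool × Bool), h.length < F → ValidHist R code σ h → ∃ w, w.length = s ∧ R h w) :
    ∃ h : List (List Bool × Bool), h.length = F ∧ ValidHist R code σ h ∧
      stream δ σ m (s + m + 1) (F * (s + m + 1)) (F * (s + m + 1)) = flat code h :=
  exists_validHist_stream_eq himpl hcode hs hex le_rfl F le_rfl

end Run

end FKTransfer

end Literature.Computability.Complexity
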